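import Literature.NumberTheory.EllipticCurves.ZpExtensionLayerCharacter
import Mathlib.RingTheory.RootsOfUnity.Complex
import HarnessLib

/-!
# Complex characters of the layers of a `ℤ_p`-extension: for every `n` a continuous character
# `χ : Γ_K →ₜ* ℂˣ` trivial on `Gal(K̄/K_{n+1})` with `χ(γ)` a PRIMITIVE `p^{n+1}`-th root of unity (Washington §13.1)

Topic `NumberTheory/EllipticCurves` (next to `ZpExtensionLayerCharacter`), namespace
`Literature.NumberTheory.EllipticCurves.ZpExtension`.  Typed by seat `bsd-cm-prr-ty1` g30 (literature-prover, cell bsd-cm) to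
DISCHARGE the binder `hχ` («characters of every primitive level exist») of the K2ᶜ input form of crux
`EllipticUnitValueSevenOfGZK` (stmt-BirchSwinnertonDyer-19945; `Summits/…/Additive/RamifiedSevenIntegralComparisonOfInputs.lean`).
Proof: compose the tree's layer character `ψ_{n+1} = κ mod p^{n+1} : Γ_K ↠ ℤ/p^{n+1}` (`exists_cyclicCharacter_layer`, kernel
`κ⁻¹(p^{n+1}ℤ_p) = layerSubgroup (n+1)`) with `a ↦ ζ^a`, `ζ = exp(2πi/p^{n+1})` (`Complex.isPrimitiveRoot_exp`); a topological
generator `γ` has `κ γ = 1`, so `ψ γ = 1` and `χ γ = ζ`.  THEOREMS ONLY; no definition, fact, instance or notation.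

References: L. C. Washington, *Introduction to Cyclotomic Fields* (1997) §13.1 (`Gal(K_n/K) ≃ ℤ/p^n`), §13.2 [Washington1997].
-/

noncomputable section

open Function Field NumberField Complex

namespace Literature.NumberTheory.EllipticCurves.ZpExtension

open Literature.NumberTheory.GaloisRepresentations

variable {K : Type} [Field K] [NumberField K] {p : ℕ} [hp : Fact p.Prime] (κ : ZpExtension K p)

/-- `u^{k mod N} = u^k` for `u^N = 1` (helper; the same one-liner exists in unrelated Summits files). [cite: Washington1997, §13.1] -/
private theorem units_pow_mod_eq {M : Type*} [Monoid M] {u : M} {N : ℕ} (hu : u ^ N = 1) (k : ℕ) :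
    u ^ (k % N) = u ^ k := by
  conv_rhs => rw [← Nat.mod_add_div k N, pow_add, pow_mul, hu, one_pow, mul_one]

/-- **A complex character of exact level `n+1`**: for a `ℤ_p`-extension `κ` of a number field `K` with topological generator
`γ` and every `n`, there is a continuous character `χ : Γ_K →ₜ* ℂˣ` that is trivial on `κ.layerSubgroup (n+1) = Gal(K̄/K_{n+1})`
and takes at `γ` the value `exp(2πi/p^{n+1})`, a PRIMITIVE `p^{n+1}`-th root of unity.
[cite: Washington1997, §13.1 (Gal(K_n/K) ≃ ℤ/p^n ℤ) and §13.2] -/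
theorem exists_continuousMonoidHom_layer_isPrimitiveRoot {γ : absoluteGaloisGroup K} (hγ : κ.IsTopGenerator γ) (n : ℕ) :
    ∃ χ : absoluteGaloisGroup K →ₜ* ℂˣ,
      (∀ σ ∈ κ.layerSubgroup (n + 1), χ σ = 1) ∧ IsPrimitiveRoot (((χ γ : ℂˣ)) : ℂ) (p ^ (n + 1)) := by
  classical
  obtain ⟨ψ, hker, -, hψ⟩ := κ.exists_cyclicCharacter_layer (n + 1)
  have hN0 : p ^ (n + 1) ≠ 0 := pow_ne_zero _ hp.out.ne_zero
  haveI : NeZero (p ^ (n + 1)) := ⟨hN0⟩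
  haveI : Fact (1 < p ^ (n + 1)) := ⟨Nat.one_lt_pow (Nat.succ_ne_zero n) hp.out.one_lt⟩
  -- the primitive root and the unit it defines
  have hζ : IsPrimitiveRoot (exp (2 * Real.pi * I / (p ^ (n + 1) : ℕ))) (p ^ (n + 1)) :=
    Complex.isPrimitiveRoot_exp _ hN0
  obtain ⟨u, hu⟩ : ∃ u : ℂˣ, (u : ℂ) = exp (2 * Real.pi * I / (p ^ (n + 1) : ℕ)) :=
    ⟨Units.mk0 _ (exp_ne_zero _), rfl⟩
  have huN : u ^ (p ^ (n + 1)) = 1 := by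
    ext; rw [Units.val_pow_eq_pow_val, hu, hζ.pow_eq_one, Units.val_one]
  -- the character `σ ↦ u^{ψ σ}`
  let f : absoluteGaloisGroup K →* ℂˣ :=
    { toFun := fun σ => u ^ (ψ σ).val
      map_one' := by rw [ψ.map_one, ZMod.val_zero, pow_zero]
      map_mul' := fun σ τ => by rw [ψ.map_mul, ZMod.val_add, units_pow_mod_eq huN, pow_add] }
  have hf : ∀ σ, f σ = u ^ (ψ σ).val := fun _ => rfl
  have hcont : Continuous f := by
    change Continuous ((fun a : ZMod (p ^ (n + 1)) => u ^ a.val) ∘ ψ)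
    exact continuous_of_discreteTopology.comp ψ.continuous
  refine ⟨⟨f, hcont⟩, fun σ hσ => ?_, ?_⟩
  · change f σ = 1
    rw [← hker, CyclicCharacter.mem_ker] at hσ
    rw [hf, hσ, ZMod.val_zero, pow_zero]
  · change IsPrimitiveRoot (((f γ : ℂˣ)) : ℂ) (p ^ (n + 1))
    have hψγ : ψ γ = 1 := by
      rw [hψ, hγ, toAdd_ofAdd, map_one]
    rw [hf, hψγ, ZMod.val_one, pow_one, hu]
    exact hζ

end Literature.NumberTheory.EllipticCurves.ZpExtension

end
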